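import Literature.Topology.FourManifolds.HandleAttachingMapsShrink
import Literature.Topology.FourManifolds.HandleAttachingMapsLocality
import Literature.Topology.FourManifolds.HandleAttachingMapsAssoc
import HarnessLib

/-!
# N3 (`stub_STgeo`) ▸ N3-nat ▸ pieces N3d-0/2/4: LOCALITY OF HANDLE ATTACHMENTS ON DATA —
# shrinking the tubes of a multi-attachment keeps the manifold AND the base embedding
(wave 8, brick J7-1 of stub `stub_STgeo` = node N3 of NF4, line `modp-braid-orbits`, crux
`ConvexBisection.AcyclicBisectionExists`, item stmt-SmoothPoincare4-10508; registered sub-goal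
`helper_exists_multiAttachmentData_shrink`; design file `work/design/N3d_Pieces_Design.lean` (J7, wave 8),
tool (c) of its §0 and the first brick of the sub-pieces `piece0_squeeze` (N3d-0), `piece2_cancelPairs`
(N3d-2), `piece4_respaceDuals` (N3d-6a).)

Kosinski's locality (VI §6 with VI §1: the attached manifold depends only on the attaching map near the
attaching sphere) is in the tree as `IsMultiAttachment.of_eqOn_near_sphere`, which returns the bare
existence of an attachment.  Every consumer in the N3 pieces needs the DATA form: the same manifold `P`,
the SAME base embedding `jA` on every point (the cores agree, `coresComplement` is the same set), and
the same handle embeddings near the belts — because seam clauses (`bX.incl y = D.jA a → …`) are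
statements about `jA` and would otherwise be lost (G4's finding F1 "ISO gives no data").  This file
builds the data from the tree's `LocalityData` (whose `ccCongr` is the identity on points and whose
`jB'` agrees with `jB` on `{|x_λ|² < ε}`), and specialises to shrinking (`HandleAttachingMap.shrink`).
Everything is proved; no definitions.
References: A. A. Kosinski, *Differential Manifolds* (1993), VI §1, §6 [Kosinski1993].
-/

noncomputable section

-- the prescribed namespace `Summit.<P>.<Sub>.…` duplicates `SmoothPoincare4` (P = Sub)
set_option linter.dupNamespace false

open scoped Manifold ContDiff Topology Real
open Set Function

namespace Summit.SmoothPoincare4.SmoothPoincare4.Theorems.AcyclicBisectionExists.ModpBraidOrbits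

open Literature.Topology.FourManifolds Literature.Topology.FourManifolds.HandleAttachingMap

/-! ## §1 Data along a family with the same germ at the attaching spheres -/

section Tool

universe u

variable {n k : ℕ} {M : Type u} [TopologicalSpace M] [T2Space M]
  [ChartedSpace (EuclideanHalfSpace (n + 1)) M] [IsManifold (𝓡∂ (n + 1)) ∞ M]
  {ι : Type*} [Finite ι] {g h : ι → HandleAttachingMap n k M}
  {P : Type*} [TopologicalSpace P] [ChartedSpace (EuclideanHalfSpace (n + 1)) P]
  [IsManifold (𝓡∂ (n + 1)) ∞ P]

/-- **Locality of handle attachments, DATA form with the SAME base embedding** (Kosinski 1993, VI §6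
with VI §1): if `gᵢ = h̄ᵢ` on `{|y_λ|² > 1 − ε}` and the `h̄ᵢ` have pairwise disjoint ranges, every
multi-attachment DATA along `g` on `P` yields multi-attachment data along `h̄` on the same `P` whose
base embedding is the old one on every point (the cores agree) and whose handle embeddings are the old
ones on `{|x_λ|² < ε}` (near the belts).  This is the form in which shrinking tubes keeps seam clauses
(G4 finding F1: the tree's `of_eqOn_near_sphere` returns only the ∃). [cite: Kosinski1993, VI §6] -/
theorem exists_multiAttachmentData_of_eqOn_near_sphere
    (D : MultiAttachmentData g (𝓡∂ (n + 1)) P) {ε : ℝ} (hε : 0 < ε)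
    (heq : ∀ i (y : ↥(handleTube n k)), 1 - ε < lamSq k (y.1.1 : EuclideanSpace ℝ (Fin (n + 1))) →
      (g i).toFun y = (h i).toFun y)
    (hdisj : Pairwise fun i j => Disjoint (range (h i).toFun) (range (h j).toFun)) :
    ∃ D' : MultiAttachmentData h (𝓡∂ (n + 1)) P,
      (∀ a : ↥(coresComplement h), ∃ ha : (a : M) ∈ coresComplement g, D'.jA a = D.jA ⟨a, ha⟩) ∧
      (∀ (i : ι) (b : ↥(beltPiece n k)), lamSq k (b.1.1 : EuclideanSpace ℝ (Fin (n + 1))) < ε →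
        D'.jB i b = D.jB i b) := by
  let L : LocalityData g h P :=
    { ε := ε, ε_pos := hε, eqOn := heq, disjoint := hdisj, disjointG := D.disjoint, jA := D.jA,
      jB := D.jB, hjA := D.hjA, hjAo := D.hjAo, hjB := D.hjB, cover := D.cover, glue := D.glue,
      disjointB := D.disjointB }
  have hr : range (L.jA ∘ L.ccCongr) = range L.jA := L.ccCongr.surjective.range_comp _
  refine ⟨{ disjoint := L.disjoint, jA := L.jA ∘ L.ccCongr, jB := L.jB',
            hjA := L.hjA.comp_openPartialHomeomorph L.ccCongr.toHomeomorph.toOpenPartialHomeomorph rfl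
              (L.ccCongr.contMDiff.contMDiffOn.congr fun _ _ => rfl)
              (L.ccCongr.symm.contMDiff.contMDiffOn.congr fun _ _ => rfl),
            hjAo := by rw [hr]; exact L.hjAo, hjB := L.isSmoothEmbedding_jB', cover := L.cover',
            glue := L.jA_eq_jB'_iff, disjointB := L.disjointB' }, fun a => ?_, fun i b hb => ?_⟩
  · exact ⟨L.mem_coresComplement_iff.1 a.2, rfl⟩
  · exact L.jB'_of_lt i hb

/-! ## §2 Shrinking the tubes -/

/-- **Shrinking the tubes of a multi-attachment keeps the data** (same `P`, same base embedding on
every point, same handle embeddings near the belts): the data form of the tree's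
`isMultiAttachment_shrink_iff`. [cite: Kosinski1993, VI §6] -/
theorem exists_multiAttachmentData_shrink [Nonempty ↥(handleTube n k)]
    (D : MultiAttachmentData h (𝓡∂ (n + 1)) P) {ε : ℝ} (hε : 0 < ε) (hε2 : 2 * ε ≤ 1) :
    ∃ D' : MultiAttachmentData (fun i => (h i).shrink hε hε2) (𝓡∂ (n + 1)) P,
      (∀ a : ↥(coresComplement fun i => (h i).shrink hε hε2), ∃ ha : (a : M) ∈ coresComplement h,
        D'.jA a = D.jA ⟨a, ha⟩) ∧
      (∀ (i : ι) (b : ↥(beltPiece n k)), lamSq k (b.1.1 : EuclideanSpace ℝ (Fin (n + 1))) < ε →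
        D'.jB i b = D.jB i b) :=
  exists_multiAttachmentData_of_eqOn_near_sphere D hε
    (fun i _ hy => ((h i).shrink_apply_of_lt hε hε2 hy).symm)
    (fun i j hij => Set.disjoint_of_subset ((h i).range_shrink_subset_range hε hε2)
      ((h j).range_shrink_subset_range hε hε2) (D.disjoint hij))

end Tool

/-! ## Registered helper -/

/-- **Registered helper `helper_exists_multiAttachmentData_shrink` (sub-goal of `stub_STgeo` ▸ N3-nat ▸
N3d-0/2/6, wave 8, lead c5): shrinking the tubes of a multi-attachment keeps the data, with the same base
embedding on every point and the same handle embeddings near the belts.** [cite: Kosinski1993, VI §6] -/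
theorem helper_exists_multiAttachmentData_shrink : ∀ (n k : ℕ) (M : Type) [TopologicalSpace M] [T2Space M] [ChartedSpace (EuclideanHalfSpace (n + 1)) M] [IsManifold (𝓡∂ (n + 1)) ∞ M] [Nonempty ↥(Literature.Topology.FourManifolds.handleTube n k)] (ι : Type) [Finite ι] (h : ι → Literature.Topology.FourManifolds.HandleAttachingMap n k M) (P : Type) [TopologicalSpace P] [ChartedSpace (EuclideanHalfSpace (n + 1)) P] [IsManifold (𝓡∂ (n + 1)) ∞ P] (D : Literature.Topology.FourManifolds.HandleAttachingMap.MultiAttachmentData h (𝓡∂ (n + 1)) P) (ε : ℝ) (hε : 0 < ε) (hε2 : 2 * ε ≤ 1), ∃ D' : Literature.Topology.FourManifolds.HandleAttachingMap.MultiAttachmentData (fun i => (h i).shrink hε hε2) (𝓡∂ (n + 1)) P, (∀ a : ↥(Literature.Topology.FourManifolds.HandleAttachingMap.coresComplement fun i => (h i).shrink hε hε2), ∃ ha : (a : M) ∈ Literature.Topology.FourManifolds.HandleAttachingMap.coresComplement h, D'.jA a = D.jA ⟨a, ha⟩) ∧ (∀ (i : ι) (b : ↥(Literature.Topology.FourManifolds.beltPiece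 n k)), Literature.Topology.FourManifolds.lamSq k (b.1.1 : EuclideanSpace ℝ (Fin (n + 1))) < ε → D'.jB i b = D.jB i b) :=
  fun _ _ _ _ _ _ _ _ _ _ _ _ _ _ _ D _ hε hε2 => exists_multiAttachmentData_shrink D hε hε2

end Summit.SmoothPoincare4.SmoothPoincare4.Theorems.AcyclicBisectionExists.ModpBraidOrbits

end
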